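import Summits.RiemannHypothesis.RiemannHypothesis.Theorems.GroundBartaPolarPerronFrobeniusThinLayerCoercive
import HarnessLib

/-!
# RiemannHypothesis / GroundBarta — crux `PolarPerronFrobenius` (stmt-RiemannHypothesis-18390):
# thin-layer log-coercivity of Weil's Markov form, part 2: NUMERICS and the one-layer form

Helper file (`--supports stmt-RiemannHypothesis-18390`), RH-free, Mathlib + proved tree files only,
no definitions, no named facts.  Part 1 (`…ThinLayerCoercive.lean`) proved the exact bounds
`Q₀(g) ≥ ‖g‖₂² (2∫_ζ^∞ w − c_A)` (one layer of width `ζ < log 2`) and its two-layer form with the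
resonant band removed.  Here the constants are evaluated with elementary certified bounds:

* `tl_setIntegral_Ioi_weilArchDensity_ge`: `∫_ζ^∞ w ≥ ½ log(1/ζ) − 1/4 + 6/5` for `0 < ζ ≤ 1`
  (`w(t) ≥ e^{-t/2}/(2t) ≥ 1/(2t) − 1/4` on `(0,1]`, `w(t) ≥ e^{-t/2}` on `(1, ∞)`, `2e^{-1/2} ≥ 6/5`);
* `tl_archKilling_le`: `c_A = 2∫₀^∞ (e^{t/2}−1)/(2 sinh t) dt + log 4π + γ ≤ 33/5`
  (`≤ e^{1/2}/4` on `(0,1]`, `≤ e^{-t/2}` beyond, `log 4π < 13/5`, `γ < 2/3`; true value `5.372…`);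
* `tl_thinLayer_coercive`: **`(log(1/ζ) − 5) ‖g‖₂² ≤ Q₀(g)`** for every test `g` supported in a layer
  `[c, c + ζ]`, `0 < ζ < log 2` (window-free; true constant `≈ 2.42`);
The two-edge-layer engine of the harmonic-majorant line (`a‖g‖₂² ≤ Q₀(g)` on
`[-a,-a+ζ] ∪ [a−ζ,a]`, `a ≥ 5`, `ζ ≤ e^{-2a}/4`) is part 3 (`…ThinLayerCoerciveEdgeLayers.lean`).

Prover B, speedrun unit `sr-gb-rung-b` (seat 2).
-/

set_option linter.dupNamespace false

noncomputable section

open Set MeasureTheory Filter Complex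
open scoped Real Topology

namespace Summit.RiemannHypothesis.RiemannHypothesis.Theorems.PolarPerronFrobenius

open Literature.NumberTheory.LFunctions
open scoped ArithmeticFunction.vonMangoldt

/-! ## Elementary constants -/

/-- `e^{1/2} < 33/20` (`(33/20)² = 2.7225 > e`). [folklore] -/
theorem tl_exp_half_lt : Real.exp (1 / 2) < 33 / 20 := by
  have h : Real.exp (1 / 2) ^ 2 = Real.exp 1 := by
    rw [← Real.exp_nat_mul]; norm_num
  have h1 : Real.exp 1 < 2.7182818286 := Real.exp_one_lt_d9
  nlinarith [Real.exp_pos (1 / 2)]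

/-- `41/25 < e^{1/2}` (`(41/25)² = 2.6896 < e`). [folklore] -/
theorem tl_lt_exp_half : 41 / 25 < Real.exp (1 / 2) := by
  have h : Real.exp (1 / 2) ^ 2 = Real.exp 1 := by
    rw [← Real.exp_nat_mul]; norm_num
  have h1 : 2.7182818283 < Real.exp 1 := Real.exp_one_gt_d9
  nlinarith [Real.exp_pos (1 / 2)]

/-- `6/5 ≤ 2 e^{-1/2}`. [folklore] -/
theorem tl_two_mul_exp_neg_half_ge : 6 / 5 ≤ 2 * Real.exp (-(1 / 2)) := by
  have h := tl_exp_half_lt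
  have hpos := Real.exp_pos (1 / 2)
  rw [Real.exp_neg]
  have h1 : (33 / 20 : ℝ)⁻¹ < (Real.exp (1 / 2))⁻¹ := by
    gcongr
  nlinarith

/-- `log 4π + γ < 33/10` (`4π < 12.6 < e^{13/5}`, `γ < 2/3`). [folklore] -/
theorem tl_log_four_pi_add_euler_lt : Real.log (4 * π) + Real.eulerMascheroniConstant < 33 / 10 := by
  have hγ := Real.eulerMascheroniConstant_lt_two_thirds
  have hπ : 4 * π < 12.6 := by linarith [Real.pi_lt_d2]
  have he : (12.6 : ℝ) < Real.exp (13 / 5) := by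
    have h2 : (2.7182818283 : ℝ) ^ 2 < Real.exp 2 := by
      have := Real.exp_one_gt_d9
      rw [show (2 : ℝ) = (2 : ℕ) * 1 by norm_num, Real.exp_nat_mul]
      gcongr
    have h3 : (1 : ℝ) + 3 / 5 + (3 / 5) ^ 2 / 2 ≤ Real.exp (3 / 5) :=
      Real.quadratic_le_exp_of_nonneg (by norm_num)
    rw [show (13 : ℝ) / 5 = 2 + 3 / 5 by norm_num, Real.exp_add]
    nlinarith [Real.exp_pos (2 : ℝ), Real.exp_pos (3 / 5 : ℝ)]
  have hlog : Real.log (4 * π) < 13 / 5 := by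
    rw [Real.log_lt_iff_lt_exp (by positivity)]
    linarith
  linarith

/-! ## The archimedean density from below -/

/-- `w(t) ≥ e^{-t/2}` for `t > 0` (`2 sinh t ≤ e^t`). [folklore] -/
theorem tl_exp_neg_half_le_weilArchDensity {t : ℝ} (ht : 0 < t) :
    Real.exp (-(t / 2)) ≤ weilArchDensity t := by
  have hs : 0 < 2 * Real.sinh t := mul_pos two_pos (Real.sinh_pos_iff.2 ht)
  unfold weilArchDensity
  rw [le_div_iff₀ hs]
  have h1 : 2 * Real.sinh t ≤ Real.exp t := by
    rw [Real.sinh_eq]; linarith [Real.exp_pos (-t)]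
  have h2 : Real.exp (-(t / 2)) * Real.exp t = Real.exp (t / 2) := by
    rw [← Real.exp_add]; congr 1; ring
  calc Real.exp (-(t / 2)) * (2 * Real.sinh t) ≤ Real.exp (-(t / 2)) * Real.exp t :=
        mul_le_mul_of_nonneg_left h1 (Real.exp_pos _).le
    _ = Real.exp (t / 2) := h2

/-- `w(t) ≥ 1/(2t) − 1/4` for `t > 0` (`w(t) ≥ e^{-t/2}/(2t)` and `e^{-t/2} ≥ 1 − t/2`). [folklore] -/
theorem tl_inv_sub_le_weilArchDensity {t : ℝ} (ht : 0 < t) :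
    1 / (2 * t) - 1 / 4 ≤ weilArchDensity t := by
  have h := exp_neg_half_div_le_weilArchDensity ht
  have h1 : 1 - t / 2 ≤ Real.exp (-(t / 2)) := by linarith [Real.add_one_le_exp (-(t / 2))]
  have h2 : 1 / (2 * t) - 1 / 4 = (1 - t / 2) / (2 * t) := by field_simp; ring
  rw [h2]
  exact (div_le_div_of_nonneg_right h1 (by positivity)).trans h

/-- **The archimedean tail from below**: `∫_ζ^∞ w ≥ ½ log(1/ζ) − 1/4 + 6/5` for `0 < ζ ≤ 1`
(true value `½ log(1/ζ) + 1.478… + o(1)`). [folklore] -/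
theorem tl_setIntegral_Ioi_weilArchDensity_ge {ζ : ℝ} (hζ : 0 < ζ) (hζ1 : ζ ≤ 1) :
    Real.log (1 / ζ) / 2 - 1 / 4 + 6 / 5 ≤ ∫ t in Ioi ζ, weilArchDensity t := by
  have hwi : IntegrableOn weilArchDensity (Ioi ζ) := integrableOn_weilArchDensity_Ioi hζ
  -- split `(ζ, ∞) = (ζ, 1] ∪ (1, ∞)`
  have hsplit : ∫ t in Ioi ζ, weilArchDensity t =
      (∫ t in Ioc ζ 1, weilArchDensity t) + ∫ t in Ioi 1, weilArchDensity t := by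
    rw [← Ioc_union_Ioi_eq_Ioi hζ1, setIntegral_union (Ioc_disjoint_Ioi le_rfl) measurableSet_Ioi
      (hwi.mono_set Ioc_subset_Ioi_self) (hwi.mono_set (Ioi_subset_Ioi hζ1))]
  -- the piece `(ζ, 1]`
  have hA : Real.log (1 / ζ) / 2 - 1 / 4 ≤ ∫ t in Ioc ζ 1, weilArchDensity t := by
    have hci : IntegrableOn (fun t : ℝ ↦ 1 / (2 * t) - 1 / 4) (Ioc ζ 1) := by
      refine (ContinuousOn.integrableOn_compact isCompact_Icc ?_).mono_set Ioc_subset_Icc_self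
      exact (continuousOn_const.div (continuousOn_const.mul continuousOn_id)
        fun t ht ↦ mul_ne_zero two_ne_zero (hζ.trans_le ht.1).ne').sub continuousOn_const
    have hle : ∫ t in Ioc ζ 1, (1 / (2 * t) - 1 / 4) ≤ ∫ t in Ioc ζ 1, weilArchDensity t :=
      setIntegral_mono_on hci (hwi.mono_set Ioc_subset_Ioi_self) measurableSet_Ioc
        fun t ht ↦ tl_inv_sub_le_weilArchDensity (hζ.trans ht.1)
    have hval : ∫ t in Ioc ζ 1, (1 / (2 * t) - 1 / 4) = Real.log (1 / ζ) / 2 - (1 - ζ) / 4 := by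
      rw [← intervalIntegral.integral_of_le hζ1,
        intervalIntegral.integral_sub ?_ ?_, intervalIntegral.integral_const]
      · have h1 : ∫ t in ζ..1, 1 / (2 * t) = (1 / 2) * ∫ t in ζ..1, t⁻¹ := by
          rw [← intervalIntegral.integral_const_mul]
          congr 1 with t
          field_simp
        rw [h1, integral_inv_of_pos hζ one_pos]
        simp only [smul_eq_mul]
        ring
      · exact (continuousOn_const.div (continuousOn_const.mul continuousOn_id)
          fun t ht ↦ mul_ne_zero two_ne_zero (hζ.trans_le ht.1).ne').intervalIntegrable_of_Icc hζ1
      · exact intervalIntegrable_const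
    have hζ4 : 0 ≤ (1 - ζ) / 4 := by linarith
    linarith [hle, hval]
  -- the piece `(1, ∞)`
  have hB : 6 / 5 ≤ ∫ t in Ioi 1, weilArchDensity t := by
    have hei : IntegrableOn (fun t : ℝ ↦ Real.exp (-(1 / 2) * t)) (Ioi 1) :=
      exp_neg_integrableOn_Ioi 1 (by norm_num)
    have hle : ∫ t in Ioi 1, Real.exp (-(1 / 2) * t) ≤ ∫ t in Ioi 1, weilArchDensity t :=
      setIntegral_mono_on hei (hwi.mono_set (Ioi_subset_Ioi hζ1)) measurableSet_Ioi
        fun t ht ↦ by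
          have h := tl_exp_neg_half_le_weilArchDensity (zero_lt_one.trans ht)
          have he : -(1 / 2) * t = -(t / 2) := by ring
          rwa [he]
    have hval : ∫ t in Ioi 1, Real.exp (-(1 / 2) * t) = 2 * Real.exp (-(1 / 2)) := by
      rw [integral_exp_mul_Ioi (by norm_num) 1]
      ring
    linarith [tl_two_mul_exp_neg_half_ge]
  linarith

/-! ## The archimedean killing constant from above -/

/-- On `(0, 1]`: `(e^{t/2} − 1)/(2 sinh t) ≤ e^{1/2}/4` (`e^{t/2} − 1 ≤ (t/2)e^{t/2}`, `sinh t ≥ t`).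
[folklore] -/
theorem tl_killingDensity_le_of_le_one {t : ℝ} (ht : 0 < t) (ht1 : t ≤ 1) :
    (Real.exp (t / 2) - 1) / (2 * Real.sinh t) ≤ Real.exp (1 / 2) / 4 := by
  have hs : t ≤ Real.sinh t := Real.self_le_sinh_iff.2 ht.le
  have hs0 : 0 < 2 * Real.sinh t := mul_pos two_pos (Real.sinh_pos_iff.2 ht)
  have hE : 0 < Real.exp (t / 2) := Real.exp_pos _
  -- `1 − e^{-t/2} ≤ t/2`, i.e. `e^{t/2} − 1 ≤ (t/2) e^{t/2}`
  have h1 : Real.exp (t / 2) - 1 ≤ t / 2 * Real.exp (t / 2) := by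
    have h := Real.add_one_le_exp (-(t / 2))
    have hm : Real.exp (-(t / 2)) * Real.exp (t / 2) = 1 := by
      rw [← Real.exp_add]; simp
    nlinarith
  have h2 : Real.exp (t / 2) ≤ Real.exp (1 / 2) := Real.exp_le_exp.2 (by linarith)
  rw [div_le_div_iff₀ hs0 (by norm_num : (0 : ℝ) < 4)]
  nlinarith

/-- **The archimedean killing integral from above**: `∫₀^∞ (e^{t/2} − 1)/(2 sinh t) dt ≤ 33/20`
(true value `1.132…`). [folklore] -/
theorem tl_setIntegral_killingDensity_le :
    ∫ t in Ioi (0 : ℝ), (Real.exp (t / 2) - 1) / (2 * Real.sinh t) ≤ 33 / 20 := by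
  have hki := integrableOn_weilKillingDensity
  have hsplit : ∫ t in Ioi (0 : ℝ), (Real.exp (t / 2) - 1) / (2 * Real.sinh t) =
      (∫ t in Ioc (0 : ℝ) 1, (Real.exp (t / 2) - 1) / (2 * Real.sinh t)) +
        ∫ t in Ioi (1 : ℝ), (Real.exp (t / 2) - 1) / (2 * Real.sinh t) := by
    rw [← Ioc_union_Ioi_eq_Ioi zero_le_one, setIntegral_union (Ioc_disjoint_Ioi le_rfl)
      measurableSet_Ioi (hki.mono_set Ioc_subset_Ioi_self) (hki.mono_set (Ioi_subset_Ioi zero_le_one))]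
  have hA : ∫ t in Ioc (0 : ℝ) 1, (Real.exp (t / 2) - 1) / (2 * Real.sinh t) ≤ Real.exp (1 / 2) / 4 := by
    have h := setIntegral_mono_on (hki.mono_set Ioc_subset_Ioi_self)
      (integrableOn_const (by simp)) measurableSet_Ioc
      (fun t ht ↦ tl_killingDensity_le_of_le_one ht.1 ht.2)
      (g := fun _ ↦ Real.exp (1 / 2) / 4)
    rw [setIntegral_const] at h
    simpa using h
  have hB : ∫ t in Ioi (1 : ℝ), (Real.exp (t / 2) - 1) / (2 * Real.sinh t) ≤ 2 * Real.exp (-(1 / 2)) := by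
    have hei : IntegrableOn (fun t : ℝ ↦ Real.exp (-(1 / 2) * t)) (Ioi 1) :=
      exp_neg_integrableOn_Ioi 1 (by norm_num)
    have h := setIntegral_mono_on (hki.mono_set (Ioi_subset_Ioi zero_le_one)) hei measurableSet_Ioi
      (fun t ht ↦ weilKillingDensity_le (zero_lt_one.trans ht))
    have hval : ∫ t in Ioi 1, Real.exp (-(1 / 2) * t) = 2 * Real.exp (-(1 / 2)) := by
      rw [integral_exp_mul_Ioi (by norm_num) 1]
      ring
    linarith
  have hC : Real.exp (1 / 2) / 4 + 2 * Real.exp (-(1 / 2)) ≤ 33 / 20 := by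
    have h1 := tl_exp_half_lt
    have h2 := tl_lt_exp_half
    have h3 : Real.exp (-(1 / 2)) = (Real.exp (1 / 2))⁻¹ := Real.exp_neg _
    rw [h3]
    have h4 : (Real.exp (1 / 2))⁻¹ < (41 / 25)⁻¹ := by
      gcongr
    nlinarith
  linarith

/-- **The archimedean share of the killing constant**:
`c_A = 2∫₀^∞ (e^{t/2}−1)/(2 sinh t) dt + log 4π + γ ≤ 33/5` (true value `5.372…`). [folklore] -/
theorem tl_archKilling_le :
    2 * (∫ t in Ioi (0 : ℝ), (Real.exp (t / 2) - 1) / (2 * Real.sinh t)) +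
        (Real.log (4 * π) + Real.eulerMascheroniConstant) ≤ 33 / 5 := by
  linarith [tl_setIntegral_killingDensity_le, tl_log_four_pi_add_euler_lt]

/-! ## One thin layer: the numerical form -/

section OneLayer

variable {g : ℝ → ℂ} {c ζ : ℝ}

/-- **Thin-layer log-coercivity of Weil's Markov form.**  For every test `g` supported in a layer
`[c, c + ζ]` of width `0 < ζ < log 2`,
`(log(1/ζ) − 5) · ‖g‖₂² ≤ Q₀(g) = Re Q(g) − P(g)`
— window-free and prime-free (the sharp constant is `2∫_ζ^∞ w − c_A − log(1/ζ) → −2.42…`). [folklore] -/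
theorem tl_thinLayer_coercive (hg : IsWeilTest g) (hζ : 0 < ζ) (hζ2 : ζ < Real.log 2)
    (hS : tsupport g ⊆ Icc c (c + ζ)) :
    (Real.log (1 / ζ) - 5) * ∫ x : ℝ, ‖g x‖ ^ 2 ≤ weilMarkovQuadratic g := by
  have h := tl_weilMarkovQuadratic_ge_of_thinLayer hg hζ hζ2 hS
  have hζ1 : ζ ≤ 1 := by linarith [Real.log_two_lt_d9]
  have h1 := tl_setIntegral_Ioi_weilArchDensity_ge hζ hζ1
  have h2 := tl_archKilling_le
  have hN0 : 0 ≤ ∫ x : ℝ, ‖g x‖ ^ 2 := integral_nonneg fun x ↦ by positivity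
  nlinarith

end OneLayer

end Summit.RiemannHypothesis.RiemannHypothesis.Theorems.PolarPerronFrobenius

end
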